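/-
Copyright (c) 2026. All rights reserved.
Released under Apache 2.0 license as described in the file LICENSE.
Authors: abc-iut cell, prover seat abc-iut-w4-d095 (wave 4, gen 5).
-/
import Literature.AnabelianGeometry.AbsoluteAnabelian.LogFrobeniusMonoGenuineModel
import Literature.AnabelianGeometry.AbsoluteAnabelian.LogFrobeniusMonoCoresNecessity
import HarnessLib

/-!
# [AbsTopIII] Cor 5.10 (iv)(b)(c) is NOT available at the genuine-mono MLF setting with its placeholder telecore edges

S. Mochizuki, *Topics in absolute anabelian geometry III: global reconstruction algorithms*, J. Math. Sci. Univ.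
Tokyo 22 (2015) 939–1156 [MochizukiAbsTopIII2015]; locators = pages of the author's manuscript
(`paper:url-5493eb38cbb7`): Cor 5.10 (iv)(b)(c) pp. 147–148 (the mono-analytic telecore `𝔗_{An⊢}` with edges
`φ^{An⊢⊞}_{w,ν} : An⊢[𝒩⊢⊞] → 𝒩⊢⊞_w` and its contact structure `ℋ_{An⊢}` containing the isomorphisms `η⊢_{v,ν}`), Prop 5.8
(i)–(iii), (vii) pp. 139–141 (the mono-anabelian containers `G ↷ 𝒪^×(G)`, `G ↷ k~(G)` reconstructed from `G` by local
class field theory, and the forgetful functors `ψ^{An⊢⊞}_{w,ν}`), Def 5.4 (iii) p. 126 (the vertex `𝒪^×_k̄` of `Γ⃗^log_v`).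

PROOF-ONLY companion of `LogFrobeniusMonoGenuineModel.lean` (this seat): a CALIBRATION for FACT-LIST row F-0139
(`Cor510MonoTelecore`).  At `LogFrobeniusSetting.nonarchGenuineMono p` the mono-analytic rows 3–7 are genuine
(`ℰ⊢ := Up 𝒯𝔾` via `W ↦ G_w`, `𝒩⊢ := ℰ⊢ × 𝒞_TS` via `(Π ↷ M) ↦ (G ↷ M)`) and Cor 5.10 (iv)(a) holds there
(`nonarchGenuineMono_cor510MonoCores`), but the telecore edges `ψ^{An⊢⊞}_{w,ν}` are the declared PLACEHOLDER
`G ↦ (G, (G ↷ pt))`.  THEOREM `nonarchGenuineMono_not_cor510MonoTelecore`: over any index set with a nonarchimedean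
place, the typed Cor 5.10 (iv)(b)(c) FAILS at this setting — by this seat's gen-3 necessity
`etaMono_iso_of_cor510MonoTelecore`, `ℋ_{An⊢}` would force an isomorphism of `TS`-pairs `(G ↷ pt) ≅ (G ↷ 𝒪^×_k̄)` at the
vertex `𝒪^×_k̄`, impossible since `1 ≠ −1` in `𝒪^×_k̄`.  READING (honest): the placeholder is DETECTED, nothing about
print is impugned — at a carrier whose `ℰ⊢` is genuinely mono-analytic (bare topological groups), (iv)(b)(c) needs the
telecore edges to carry the Prop 5.8 containers `G ↦ (G ↷ 𝒪^×(G))` FUNCTORIALLY IN ISOMORPHISMS OF `G` (local class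
field theory / [AbsAnab] Prop 1.2.1, FACT-LIST): that construction is exactly what F-0139's genuine-carrier unit must
supply.  Refereed pre-IUT material; nothing here bears on [IUTchIII] Cor. 3.12; no side taken; model-level ≠ node-level.
-/

set_option autoImplicit false

noncomputable section

open CategoryTheory

namespace Literature.AnabelianGeometry.AbsoluteAnabelian

namespace LogFrobeniusSetting

open AbsTopIII

variable (p : ℕ) [Fact p.Prime] (Vmod : Type 1) (isArc : Vmod → Bool)


/-- The cross vertex `𝒪^×_k̄` of `Γ⃗^log_v` at a nonarchimedean place, with its functor `λ⊞ = (𝟭, λ_{𝒪^×})` (stated over a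
Boolean `b = false` so that it applies to `b := isArc v₀` without transport). [cite: MochizukiAbsTopIII2015, Definition 5.4 (iii) p.126] -/
theorem exists_cross_units (b : Bool) (hb : b = false) :
    ∃ ν : LogVertex b, ν.IsCross ∧ nonarchLam p b ν = Up.liftF ((𝟭 (TFModel p)).prod' (TFModel.lamUnits p)) := by
  subst hb
  exact ⟨NonarchVertex.units, ⟨rfl, rfl⟩, rfl⟩

/-- **Cor 5.10 (iv)(b)(c) (`Cor510MonoTelecore`, F-0139) FAILS at `nonarchGenuineMono p`** over any index set with a
nonarchimedean place (and a model `TF`-pair `x₀`): by abc-iut-w4-d095 (gen 3)'s necessity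
`etaMono_iso_of_cor510MonoTelecore`, the contact structure `ℋ_{An⊢}` would force an isomorphism
`η⊢_{v,𝒪^×} : λ⊞ ⋙ … ⋙ ψ^{An⊢⊞}_{v,𝒪^×} ≅ λ⊞ ⋙ (𝒩⊞_v → 𝒩⊢⊞_v)`, i.e. — at `x₀` and on the local `TS`-components — an
isomorphism of `TS`-pairs `(G ↷ pt) ≅ (G ↷ 𝒪^×_k̄)`, impossible since `1 ≠ −1` in `𝒪^×_k̄`.  READING (honest): the
PLACEHOLDER `ψ := G ↦ (G ↷ pt)` is thereby DETECTED — at a carrier whose `ℰ⊢` is genuinely mono-analytic, (iv)(b)(c)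
needs the telecore edges to carry the mono-anabelian containers `G ↦ (G ↷ 𝒪^×(G))`, functorial in isomorphisms of
`G` (Prop 5.8 (i)–(iii); local class field theory, FACT-LIST) — the content F-0139's genuine unit must supply; nothing
about print is impugned. [cite: MochizukiAbsTopIII2015, Cor 5.10 (iv)(b)(c) pp. 147–148] -/
theorem nonarchGenuineMono_not_cor510MonoTelecore (v₀ : Vmod) (hv₀ : isArc v₀ = false) (x₀ : Up (TFModel p)) :
    ¬ (nonarchGenuineMono p Vmod isArc).Cor510MonoTelecore := by
  intro h
  obtain ⟨ν, hν, hlam⟩ := exists_cross_units p (isArc v₀) hv₀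
  obtain ⟨e⟩ := (nonarchGenuineMono p Vmod isArc).etaMono_iso_of_cor510MonoTelecore h v₀ ν hν
  rw [show (nonarchGenuineMono p Vmod isArc).lam v₀ ν = Up.liftF ((𝟭 (TFModel p)).prod' (TFModel.lamUnits p)) from hlam]
    at e
  -- the isomorphism at `x₀`, projected to the local `TS`-pair components: `(G ↷ pt) ≅ (G ↷ 𝒪^×_k̄)` in `𝒞_TS`
  let η := (inducedFunctor (ULift.down : ULift.{2} (TopGroupObj × TSObj) → TopGroupObj × TSObj) ⋙
    CategoryTheory.Prod.snd TopGroupObj TSObj).mapIso (e.app x₀)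
  -- `φ_M ∘ φ_M⁻¹ = id` on the arithmetic datum `𝒪^×_k̄` of the target pair
  have key : ∀ u, (η.hom : TSObj.Hom _ _).homM ((η.inv : TSObj.Hom _ _).homM u) = u := fun u => by
    have := congrArg (fun k => (k : TSObj.Hom _ _).homM u) η.inv_hom_id
    simp only [TSObj.comp_homM_apply, TSObj.id_homM_apply] at this
    exact this
  -- the source datum is a point, so `𝒪^×_k̄` would have at most one element
  have hsub : ∀ u u', u = u' := fun u u' => by
    have hg : (η.inv : TSObj.Hom _ _).homM u = (η.inv : TSObj.Hom _ _).homM u' := rfl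
    rw [← key u, ← key u', hg]
  have h1 := congrArg UnitsCarrier.val
    (hsub (UnitsCarrier.mk 1 (Submonoid.one_mem _)) (UnitsCarrier.mk (-1) neg_one_mem_unitSubmonoid))
  change (1 : PadicAlgCl p) = -1 at h1
  haveI : CharZero (PadicAlgCl p) := charZero_of_injective_algebraMap (algebraMap ℚ_[p] (PadicAlgCl p)).injective
  exact two_ne_zero (α := PadicAlgCl p) (by linear_combination h1)

end LogFrobeniusSetting

end Literature.AnabelianGeometry.AbsoluteAnabelian

end
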